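import Mathlib
import Summits.ValiantsHypothesis.ValiantsHypothesis.Theorems.RigidityForcesSymmetryRankRigidMinimalReprLaplaceResidualFullSupport
import Summits.ValiantsHypothesis.ValiantsHypothesis.Theorems.RigidityForcesSymmetryRankRigidMinimalReprLaplaceFiveParallelPairs

/-!
# The fibre sums of the two-slot expansion are `3 × 3` permanents; LEMMA Z for the residual `a = 3` configurations
# (crux `RankRigidMinimalRepr`, stmt-ValiantsHypothesis-18034; frontier rung `LaplaceOptimalFive`, stmt-24813)

`permanent_two_slot` (`…LaplaceResidualTools.lean`) writes the `5 × 5` permanent in covector format as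
`Σ_{x,y} φ₃(x) · F(x,y) · φ₄(y)` with the FIBRE SUM `F(x,y) = Σ_{σ : σ3 = x, σ4 = y} φ₀(σ0) φ₁(σ1) φ₂(σ2)`.  Here:

* `fibre_sum_three_four` — the concrete fibre `F(3,4)` is the `3 × 3` permanent of `φ₀,φ₁,φ₂` on the letters `0,1,2`
  (the six permutations fixing `3, 4`, by `decide` on the filtered set);
* `fibre_sum_relabel` — relabelling the letters by `π` moves the fibre: `F[φ](π 3, π 4) = F[φ ∘ π](3, 4)`;
* `fibre_sum_eq` — hence for pairwise distinct `a,b,c,x,y`: `F(x,y) = φ₀(a)·g(b,c) + φ₀(b)·g(a,c) + φ₀(c)·g(a,b)` with the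
  `2 × 2` permanents `g(p,q) = φ₁(p)φ₂(q) + φ₁(q)φ₂(p)`;
* `lemmaZ` — **if every coordinate of `φ₀` is non-zero and all fibre sums `F(x,y)`, `x ≠ y`, vanish, then all `2 × 2`
  permanents of `(φ₁;φ₂)` vanish** (`pairs_vanish_of_full_support`, `…LaplaceResidualFullSupport.lean`).

This is the CASE-1 key of the blueprint for the last four configurations of `laplace_five_three_slices_residual` (evidence note
NOTE-p8g11-24813 §v3 on stmt-24813).  No definitions.  HONEST FRAMING: infrastructure toward the frontier rung
`LaplaceOptimalFive` (stmt-24813), which stays OPEN; nothing here bears on `VP ≠ VNP`.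
-/

set_option autoImplicit false

-- the mandated summit-side namespace repeats a component by design (single-problem summit)
set_option linter.dupNamespace false

namespace Summit.ValiantsHypothesis.ValiantsHypothesis.Theorems.RigidityForcesSymmetryRankRigidMinimalRepr

namespace LaplaceResidual

open Finset

/-! ### §1 The concrete fibre over `(3, 4)` -/

/-- The permutations of `Fin 5` fixing `3` and `4`. -/
theorem filter_fix_three_four :
    (univ.filter (fun σ : Equiv.Perm (Fin 5) => σ 3 = 3 ∧ σ 4 = 4)) =
      {1, Equiv.swap 0 1, Equiv.swap 0 2, Equiv.swap 1 2, Equiv.swap 0 1 * Equiv.swap 0 2,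
        Equiv.swap 0 2 * Equiv.swap 0 1} := by
  decide

/-- **The fibre over `(3,4)` is the `3 × 3` permanent on the letters `0,1,2`.** -/
theorem fibre_sum_three_four (φ₀ φ₁ φ₂ : Fin 5 → ℂ) :
    (∑ σ : Equiv.Perm (Fin 5), if σ 3 = 3 ∧ σ 4 = 4 then φ₀ (σ 0) * φ₁ (σ 1) * φ₂ (σ 2) else 0) =
      φ₀ 0 * (φ₁ 1 * φ₂ 2 + φ₁ 2 * φ₂ 1) + φ₀ 1 * (φ₁ 0 * φ₂ 2 + φ₁ 2 * φ₂ 0) +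
        φ₀ 2 * (φ₁ 0 * φ₂ 1 + φ₁ 1 * φ₂ 0) := by
  rw [← sum_filter, filter_fix_three_four]
  rw [sum_insert (by decide), sum_insert (by decide), sum_insert (by decide), sum_insert (by decide),
    sum_insert (by decide), sum_singleton]
  simp only [Equiv.Perm.one_apply, Equiv.Perm.mul_apply]
  simp only [Equiv.swap_apply_def]
  simp only [Fin.isValue, if_true, if_false, show ((1 : Fin 5) = 0) = False by decide,
    show ((2 : Fin 5) = 0) = False by decide, show ((2 : Fin 5) = 1) = False by decide,
    show ((0 : Fin 5) = 1) = False by decide, show ((0 : Fin 5) = 2) = False by decide,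
    show ((1 : Fin 5) = 2) = False by decide]
  ring

/-! ### §2 Relabelling the letters -/

/-- Relabelling the letters by `π` moves the fibre: `F[φ](π 3, π 4) = F[φ ∘ π](3, 4)`. -/
theorem fibre_sum_relabel (φ₀ φ₁ φ₂ : Fin 5 → ℂ) (π : Equiv.Perm (Fin 5)) :
    (∑ σ : Equiv.Perm (Fin 5), if σ 3 = π 3 ∧ σ 4 = π 4 then φ₀ (σ 0) * φ₁ (σ 1) * φ₂ (σ 2) else 0) =
      ∑ τ : Equiv.Perm (Fin 5),
        if τ 3 = 3 ∧ τ 4 = 4 then φ₀ (π (τ 0)) * φ₁ (π (τ 1)) * φ₂ (π (τ 2)) else 0 := by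
  refine Fintype.sum_equiv (Equiv.mulLeft π⁻¹)
    (fun σ => if σ 3 = π 3 ∧ σ 4 = π 4 then φ₀ (σ 0) * φ₁ (σ 1) * φ₂ (σ 2) else 0)
    (fun τ => if τ 3 = 3 ∧ τ 4 = 4 then φ₀ (π (τ 0)) * φ₁ (π (τ 1)) * φ₂ (π (τ 2)) else 0) (fun σ => ?_)
  simp only [Equiv.coe_mulLeft, Equiv.Perm.coe_mul, Function.comp_apply, Equiv.Perm.coe_inv,
    Equiv.apply_symm_apply, Equiv.symm_apply_eq]

/-! ### §3 The fibre sum as a combination of `2 × 2` permanents -/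

/-- **The fibre sum over `(x, y)`** for pairwise distinct `a, b, c, x, y`:
`F(x,y) = φ₀(a) g(b,c) + φ₀(b) g(a,c) + φ₀(c) g(a,b)`, `g(p,q) = φ₁(p)φ₂(q) + φ₁(q)φ₂(p)`. -/
theorem fibre_sum_eq (φ₀ φ₁ φ₂ : Fin 5 → ℂ) (a b c x y : Fin 5) (hab : a ≠ b) (hac : a ≠ c) (hax : a ≠ x)
    (hay : a ≠ y) (hbc : b ≠ c) (hbx : b ≠ x) (hby : b ≠ y) (hcx : c ≠ x) (hcy : c ≠ y) (hxy : x ≠ y) :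
    (∑ σ : Equiv.Perm (Fin 5), if σ 3 = x ∧ σ 4 = y then φ₀ (σ 0) * φ₁ (σ 1) * φ₂ (σ 2) else 0) =
      φ₀ a * (φ₁ b * φ₂ c + φ₁ c * φ₂ b) + φ₀ b * (φ₁ a * φ₂ c + φ₁ c * φ₂ a) +
        φ₀ c * (φ₁ a * φ₂ b + φ₁ b * φ₂ a) := by
  classical
  let π : Equiv.Perm (Fin 5) := Equiv.ofBijective ![a, b, c, x, y]
    (Finite.injective_iff_bijective.mp
      (LaplaceFiveSlices.injective_vec5 a b c x y hab hac hax hay hbc hbx hby hcx hcy hxy))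
  have e0 : π 0 = a := rfl
  have e1 : π 1 = b := rfl
  have e2 : π 2 = c := rfl
  have e3 : x = π 3 := rfl
  have e4 : y = π 4 := rfl
  rw [e3, e4, fibre_sum_relabel]
  have h34 := fibre_sum_three_four (φ₀ ∘ π) (φ₁ ∘ π) (φ₂ ∘ π)
  simp only [Function.comp_apply] at h34
  rw [h34, e0, e1, e2]

/-! ### §4 LEMMA Z -/

/-- Five letters: three distinct ones have two further companions completing the alphabet. -/
theorem exists_two_others : ∀ a b c : Fin 5, a ≠ b → a ≠ c → b ≠ c → ∃ x y : Fin 5,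
    a ≠ x ∧ a ≠ y ∧ b ≠ x ∧ b ≠ y ∧ c ≠ x ∧ c ≠ y ∧ x ≠ y := by
  decide

/-- **LEMMA Z (full-support lemma for three covectors).**  If every coordinate of `φ₀` is non-zero and all fibre sums
`F(x,y)` (`x ≠ y`) of `(φ₀,φ₁,φ₂)` vanish — equivalently, all ten `3 × 3` permanents of the three covectors vanish — then
all `2 × 2` permanents `φ₁(a)φ₂(b) + φ₁(b)φ₂(a)`, `a ≠ b`, vanish. -/
theorem lemmaZ (φ₀ φ₁ φ₂ : Fin 5 → ℂ) (h0 : ∀ c, φ₀ c ≠ 0)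
    (hF : ∀ x y : Fin 5, x ≠ y →
      (∑ σ : Equiv.Perm (Fin 5), if σ 3 = x ∧ σ 4 = y then φ₀ (σ 0) * φ₁ (σ 1) * φ₂ (σ 2) else 0) = 0) :
    ∀ a b : Fin 5, a ≠ b → φ₁ a * φ₂ b + φ₁ b * φ₂ a = 0 := by
  refine pairs_vanish_of_full_support φ₀ h0 (fun p q => φ₁ p * φ₂ q + φ₁ q * φ₂ p) (fun a b c hab hac hbc => ?_)
  obtain ⟨x, y, hax, hay, hbx, hby, hcx, hcy, hxy⟩ := exists_two_others a b c hab hac hbc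
  have := hF x y hxy
  rw [fibre_sum_eq φ₀ φ₁ φ₂ a b c x y hab hac hax hay hbc hbx hby hcx hcy hxy] at this
  linear_combination this

end LaplaceResidual

end Summit.ValiantsHypothesis.ValiantsHypothesis.Theorems.RigidityForcesSymmetryRankRigidMinimalRepr
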